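import Summits.KontsevichZagierPeriods.KontsevichZagierPeriods.Theorems.ValuedFieldSpecialisationDefs
import Summits.KontsevichZagierPeriods.KontsevichZagierPeriods.Theorems.ValuedFieldSpecialisationClassLevelExpansionFibreDimOneElementaryB
import Summits.KontsevichZagierPeriods.KontsevichZagierPeriods.Theorems.ValuedFieldSpecialisationClassLevelExpansionFibreDimOnePadding

/-!
# Route ValuedFieldSpecialisation — the monomial-log families are expandable

Helper for item stmt-KontsevichZagierPeriods-3503 (`ClassLevelExpansionFibreDimOne`). The
MONOMIAL-LOG family of type `(p, q, b)` over a representation `ρ` of dimension `d` is the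
representation `M` of dimension `b + d + 1` on `{(s, y, w) | 0 < s < 1, s ≤ y_j ≤ 1, w ∈ ρ.domain}`
with integrand `s^(−p/q) · ∏ y_j⁻¹ · ρ.integrand w` — the elementary divergent product of the
item with its padding coordinate integrated out; its slice over `s` has value
`s^(−p/q) (log 1/s)^b ρ.value`. This file proves:

* `exists_monomialRep` — these representations exist for `p < q` (separable domination
  `s^(−A) ∏ y_j⁻¹ |ρ w| ≤ s^(−(A + bδ)) ∏ y_j^(−(1−δ)) |ρ w|`, `A = p/q`, `δ = (1 − A)/(2b+2)`);
* `of_monomial_mem_expandable` — for `p < q` with `0 < p ∨ 0 < b`, every representation with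
  that domain and (on it) that integrand is EXPANDABLE (`expandable` of
  `ValuedFieldSpecialisationDefs`): it is fibred-equivalent to an elementary divergent product
  (`exists_elementaryRep`, `of_elementary_sub_of_mem_fibredRelations`).

These are the target shapes to which the divergent parts of one-dimensional families are to be
reduced by fibred substitutions in the proof of the item.

Sources: M. Kontsevich, D. Zagier, *Periods* (2001), §1.1–1.2; G. Comte, J.-M. Lion, J.-P. Rolin
(2000), Thm. 1 (the monomials `s^a (log s)^b`). The families are this route's. Deliberately NOT
here: the non-divergent case `p = 0 ∧ b = 0` (a constant family, dominated) and restrictions to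
`(0, ε)` (toolkit: slab restriction).
-/

noncomputable section

namespace Summit.KontsevichZagierPeriods.ValuedFieldSpecialisation

open MeasureTheory Set Filter MvPolynomial
open scoped Topology
open Literature.NumberTheory.Transcendental Literature.NumberTheory.Transcendental.KZ
open Literature.ModelTheory.ExponentialFields (IsSemialgebraic isSemialgebraic_setOf_eval_pos
  isSemialgebraic_setOf_eval_lt isSemialgebraic_setOf_eval_le)

variable {d : ℕ}

/-! ### The monomial-log domain and integrand -/

/-- The monomial-log domain in coordinates (`0 < v 0 < 1`, `v 0 ≤ y_j ≤ 1`, `w ∈ ρ.domain`) is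
`ℚ`-semialgebraic. [Bochnak–Coste–Roy 1998, §2.1] [folklore] -/
theorem isSemialgebraic_monomialDomain (b : ℕ) (ρ : IntegralRep d) :
    IsSemialgebraic ℚ {v : Fin (b + d + 1) → ℝ | 0 < v 0 ∧ v 0 < 1 ∧
      (∀ j : Fin b, v 0 ≤ v (Fin.castAdd d j).succ ∧ v (Fin.castAdd d j).succ ≤ 1) ∧
      (fun l : Fin d => v (Fin.natAdd b l).succ) ∈ ρ.domain} := by
  have h0 : IsSemialgebraic ℚ {v : Fin (b + d + 1) → ℝ | 0 < v 0} := by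
    simpa using isSemialgebraic_setOf_eval_pos (k := ℚ) (R := ℝ) (X (0 : Fin (b + d + 1)))
  have h1 : IsSemialgebraic ℚ {v : Fin (b + d + 1) → ℝ | v 0 < 1} := by
    simpa using isSemialgebraic_setOf_eval_lt (k := ℚ) (R := ℝ) (X (0 : Fin (b + d + 1))) 1
  have h4 : IsSemialgebraic ℚ {v : Fin (b + d + 1) → ℝ | ∀ j : Fin b,
      v 0 ≤ v (Fin.castAdd d j).succ ∧ v (Fin.castAdd d j).succ ≤ 1} := by
    have : ∀ j : Fin b, IsSemialgebraic ℚ {v : Fin (b + d + 1) → ℝ |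
        v 0 ≤ v (Fin.castAdd d j).succ ∧ v (Fin.castAdd d j).succ ≤ 1} := by
      intro j
      have ha : IsSemialgebraic ℚ {v : Fin (b + d + 1) → ℝ | v 0 ≤ v (Fin.castAdd d j).succ} := by
        simpa using isSemialgebraic_setOf_eval_le (k := ℚ) (R := ℝ)
          (X (0 : Fin (b + d + 1))) (X (Fin.castAdd d j).succ)
      have hb : IsSemialgebraic ℚ {v : Fin (b + d + 1) → ℝ | v (Fin.castAdd d j).succ ≤ 1} := by
        simpa using isSemialgebraic_setOf_eval_le (k := ℚ) (R := ℝ)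
          (X (Fin.castAdd d j).succ : MvPolynomial (Fin (b + d + 1)) ℚ) 1
      simpa [setOf_and] using ha.inter hb
    convert IsSemialgebraic.biInter Finset.univ _ (fun j _ => this j) using 1
    ext v
    simp
  have h5 : IsSemialgebraic ℚ {v : Fin (b + d + 1) → ℝ |
      (fun l : Fin d => v (Fin.natAdd b l).succ) ∈ ρ.domain} :=
    ρ.isSemialgebraic_domain.preimage_comp (fun l : Fin d => (Fin.natAdd b l).succ)
  convert ((h0.inter h1).inter h4).inter h5 using 1
  ext v
  simp only [mem_setOf_eq, mem_inter_iff]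
  tauto

/-- Reassembling a point of `ℝᵇ⁺ᵈ⁺¹` from its coordinates `(s, y, w)`. [folklore] -/
theorem vecCons_append_eq {b : ℕ} (v : Fin (b + d + 1) → ℝ) :
    Matrix.vecCons (v 0) (Fin.append (fun j : Fin b => v (Fin.castAdd d j).succ)
      (fun l : Fin d => v (Fin.natAdd b l).succ)) = v := by
  funext i
  refine Fin.cases ?_ (fun k => ?_) i
  · simp
  · simp only [Matrix.cons_val_succ]
    refine Fin.addCases (fun j => ?_) (fun l => ?_) k
    · simp
    · simp

/-- The `∃`-description of the monomial-log domain agrees with the coordinate description.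
[folklore] -/
theorem monomialDomain_eq (b : ℕ) (ρ : IntegralRep d) :
    {v : Fin (b + d + 1) → ℝ | ∃ (s : ℝ) (y : Fin b → ℝ) (w : Fin d → ℝ),
      v = Matrix.vecCons s (Fin.append y w) ∧ 0 < s ∧ s < 1 ∧ (∀ j, s ≤ y j ∧ y j ≤ 1) ∧
        w ∈ ρ.domain} =
    {v | 0 < v 0 ∧ v 0 < 1 ∧
      (∀ j : Fin b, v 0 ≤ v (Fin.castAdd d j).succ ∧ v (Fin.castAdd d j).succ ≤ 1) ∧
      (fun l : Fin d => v (Fin.natAdd b l).succ) ∈ ρ.domain} := by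
  ext v
  simp only [mem_setOf_eq]
  constructor
  · rintro ⟨s, y, w, rfl, hs, hs1, hy, hw⟩
    exact ⟨by simpa using hs, by simpa using hs1, fun j => by simpa using hy j, by simpa using hw⟩
  · rintro ⟨hs, hs1, hy, hw⟩
    exact ⟨v 0, _, _, (vecCons_append_eq v).symm, hs, hs1, hy, hw⟩

/-- The integrand `s^(−p/q) · ∏ y_j⁻¹ · ρ.integrand w` is `ℚ`-semialgebraic on the monomial-log
domain (in coordinates). [BCR 1998, Prop. 2.2.6] [folklore] -/
theorem isSemialgebraicFunOn_monomialIntegrand (p q b : ℕ) (hq : 0 < q) (ρ : IntegralRep d) :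
    IsSemialgebraicFunOn ℚ {v : Fin (b + d + 1) → ℝ | 0 < v 0 ∧ v 0 < 1 ∧
      (∀ j : Fin b, v 0 ≤ v (Fin.castAdd d j).succ ∧ v (Fin.castAdd d j).succ ≤ 1) ∧
      (fun l : Fin d => v (Fin.natAdd b l).succ) ∈ ρ.domain}
      (fun v => (v 0) ^ (-(p : ℝ) / q) * ((∏ j : Fin b, (v (Fin.castAdd d j).succ)⁻¹) *
        ρ.integrand (fun l : Fin d => v (Fin.natAdd b l).succ))) := by
  have hD := isSemialgebraic_monomialDomain b ρ
  refine IsSemialgebraicFunOn.mul_holds (isSemialgebraicFunOn_rpow_zero hD (fun v hv => hv.1) hq)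
    (IsSemialgebraicFunOn.mul_holds ?_ ?_)
  · exact isSemialgebraicFunOn_finset_prod' hD Finset.univ _ fun j _ =>
      (isSemialgebraicFunOn_apply hD _).inv fun v hv => (hv.1.trans_le (hv.2.2.1 j).1).ne'
  · exact (isSemialgebraicFunOn_comp_coords ρ.isSemialgebraicFunOn_integrand
      (fun l : Fin d => (Fin.natAdd b l).succ)).mono (fun v hv => hv.2.2.2) hD

/-! ### Integrability and existence -/

/-- **Integrability of the monomial-log families** (`p < q`), by the separable domination
`s^(−A) ∏ y_j⁻¹ |ρ w| ≤ s^(−(A + bδ)) ∏ y_j^(−(1−δ)) |ρ w|` with `A = p/q`, `δ = (1 − A)/(2b+2)`.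
[folklore] -/
theorem integrableOn_monomialIntegrand {p q b : ℕ} (hpq : p < q) (ρ : IntegralRep d) :
    IntegrableOn (fun v : Fin (b + d + 1) → ℝ => (v 0) ^ (-(p : ℝ) / q) *
        ((∏ j : Fin b, (v (Fin.castAdd d j).succ)⁻¹) *
          ρ.integrand (fun l : Fin d => v (Fin.natAdd b l).succ)))
      {v | 0 < v 0 ∧ v 0 < 1 ∧
        (∀ j : Fin b, v 0 ≤ v (Fin.castAdd d j).succ ∧ v (Fin.castAdd d j).succ ≤ 1) ∧
        (fun l : Fin d => v (Fin.natAdd b l).succ) ∈ ρ.domain} := by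
  have hq : 0 < q := lt_of_le_of_lt (Nat.zero_le p) hpq
  have hq0 : (0 : ℝ) < q := by exact_mod_cast hq
  set A : ℝ := (p : ℝ) / q with hA
  have hA0 : 0 ≤ A := div_nonneg (Nat.cast_nonneg p) hq0.le
  have hA1 : A < 1 := by
    rw [hA, div_lt_one hq0]
    exact_mod_cast hpq
  have hArw : (-(p : ℝ) / q) = -A := by rw [hA, neg_div]
  set δ : ℝ := (1 - A) / (2 * (b + 1)) with hδ
  have hb1 : (0 : ℝ) < 2 * (b + 1) := by positivity
  have hδ0 : 0 < δ := div_pos (by linarith) hb1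
  have hbδ : (b : ℝ) * δ ≤ (1 - A) / 2 := by
    rw [hδ, mul_div_assoc', div_le_div_iff₀ hb1 two_pos]
    nlinarith
  set e₁ : ℝ := A + b * δ with he₁
  have he₁1 : e₁ < 1 := by rw [he₁]; linarith
  -- envelopes
  set f₁ : ℝ → ℝ := (Ioo (0 : ℝ) 1).indicator fun s => s ^ (-e₁) with hf₁
  set f₃ : ℝ → ℝ := (Ioc (0 : ℝ) 1).indicator fun y => y ^ (-(1 - δ)) with hf₃
  set f₄ : (Fin d → ℝ) → ℝ := ρ.domain.indicator fun w => |ρ.integrand w| with hf₄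
  have hf₁i : Integrable f₁ := integrable_indicator_Ioo_rpow_neg he₁1
  have hf₃i : Integrable f₃ := integrable_indicator_Ioc_rpow_neg (by linarith)
  have hf₄i : Integrable f₄ :=
    (integrable_indicator_iff (IntegralRep.measurableSet_domain_holds ρ)).mpr ρ.integrableOn.abs
  have hf₁0 : ∀ s, 0 ≤ f₁ s := fun s => by
    rw [hf₁]; exact indicator_nonneg (fun s hs => Real.rpow_nonneg hs.1.le _) s
  have hf₃0 : ∀ y, 0 ≤ f₃ y := fun y => by
    rw [hf₃]; exact indicator_nonneg (fun y hy => Real.rpow_nonneg hy.1.le _) y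
  have hf₄0 : ∀ w, 0 ≤ f₄ w := fun w => by
    rw [hf₄]; exact indicator_nonneg (fun w _ => abs_nonneg _) w
  have hΦ : Integrable (fun v : Fin (b + d + 1) → ℝ => f₁ (v 0) *
      ((∏ j : Fin b, f₃ (v (Fin.castAdd d j).succ)) * f₄ (fun l : Fin d => v (Fin.natAdd b l).succ))) :=
    integrable_cons_mul hf₁i (integrable_append_mul (integrable_pi_prod hf₃i) hf₄i)
  -- measurability
  set D := {v : Fin (b + d + 1) → ℝ | 0 < v 0 ∧ v 0 < 1 ∧
    (∀ j : Fin b, v 0 ≤ v (Fin.castAdd d j).succ ∧ v (Fin.castAdd d j).succ ≤ 1) ∧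
    (fun l : Fin d => v (Fin.natAdd b l).succ) ∈ ρ.domain} with hD
  have hDsa : IsSemialgebraic ℚ D := isSemialgebraic_monomialDomain b ρ
  have hDm : MeasurableSet D := IsSemialgebraic.measurableSet_holds hDsa
  have hFsa := isSemialgebraicFunOn_monomialIntegrand p q b hq ρ
  have hmeas := hFsa.measurable_indicator_of_tarskiSeidenberg
    Literature.ModelTheory.ExponentialFields.tarski_seidenberg_real_holds hDm
  refine (integrable_indicator_iff hDm).mp (hΦ.mono' hmeas.aestronglyMeasurable
    (Eventually.of_forall fun v => ?_))
  by_cases hv : v ∈ D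
  swap
  · rw [indicator_of_notMem hv, norm_zero]
    exact mul_nonneg (hf₁0 _) (mul_nonneg (Finset.prod_nonneg fun j _ => hf₃0 _) (hf₄0 _))
  rw [indicator_of_mem hv]
  obtain ⟨hs0, hs1, hyj, hwρ⟩ := hv
  have hypos : ∀ j : Fin b, 0 < v (Fin.castAdd d j).succ := fun j => hs0.trans_le (hyj j).1
  have hv₁ : f₁ (v 0) = v 0 ^ (-e₁) := by
    rw [hf₁, indicator_of_mem (show v 0 ∈ Ioo (0:ℝ) 1 from ⟨hs0, hs1⟩)]
  have hv₃ : ∀ j : Fin b, f₃ (v (Fin.castAdd d j).succ) = v (Fin.castAdd d j).succ ^ (-(1 - δ)) :=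
    fun j => by
      rw [hf₃, indicator_of_mem]
      exact ⟨hypos j, (hyj j).2⟩
  have hv₄ : f₄ (fun l : Fin d => v (Fin.natAdd b l).succ) =
      |ρ.integrand (fun l : Fin d => v (Fin.natAdd b l).succ)| := by
    rw [hf₄, indicator_of_mem hwρ]
  have hprod : ∏ j : Fin b, (v (Fin.castAdd d j).succ)⁻¹ ≤
      v 0 ^ (-((b : ℝ) * δ)) * ∏ j : Fin b, f₃ (v (Fin.castAdd d j).succ) := by
    calc ∏ j : Fin b, (v (Fin.castAdd d j).succ)⁻¹
        ≤ ∏ j : Fin b, (v 0 ^ (-δ) * v (Fin.castAdd d j).succ ^ (-(1 - δ))) :=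
          Finset.prod_le_prod (fun j _ => (inv_pos.mpr (hypos j)).le)
            fun j _ => inv_le_rpow_mul_rpow hs0 (hyj j).1 hδ0.le
      _ = v 0 ^ (-((b : ℝ) * δ)) * ∏ j : Fin b, f₃ (v (Fin.castAdd d j).succ) := by
          rw [Finset.prod_mul_distrib, Finset.prod_const, Finset.card_univ, Fintype.card_fin,
            ← Real.rpow_natCast, ← Real.rpow_mul hs0.le]
          congr 1
          · congr 1; ring
          · exact Finset.prod_congr rfl fun j _ => (hv₃ j).symm
  have hprod0 : 0 ≤ ∏ j : Fin b, f₃ (v (Fin.castAdd d j).succ) := Finset.prod_nonneg fun j _ => hf₃0 _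
  have habs : 0 ≤ |ρ.integrand (fun l : Fin d => v (Fin.natAdd b l).succ)| := abs_nonneg _
  have hinv0 : 0 ≤ ∏ j : Fin b, (v (Fin.castAdd d j).succ)⁻¹ :=
    Finset.prod_nonneg fun j _ => (inv_pos.mpr (hypos j)).le
  have hsA : 0 ≤ v 0 ^ (-A) := Real.rpow_nonneg hs0.le _
  rw [Real.norm_eq_abs, hArw, abs_mul, abs_mul, abs_of_nonneg hsA, abs_of_nonneg hinv0, hv₁, hv₄]
  calc v 0 ^ (-A) * ((∏ j : Fin b, (v (Fin.castAdd d j).succ)⁻¹) *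
        |ρ.integrand (fun l : Fin d => v (Fin.natAdd b l).succ)|)
      ≤ v 0 ^ (-A) * ((v 0 ^ (-((b : ℝ) * δ)) * ∏ j : Fin b, f₃ (v (Fin.castAdd d j).succ)) *
          |ρ.integrand (fun l : Fin d => v (Fin.natAdd b l).succ)|) :=
        mul_le_mul_of_nonneg_left (mul_le_mul_of_nonneg_right hprod habs) hsA
    _ = v 0 ^ (-e₁) * ((∏ j : Fin b, f₃ (v (Fin.castAdd d j).succ)) *
          |ρ.integrand (fun l : Fin d => v (Fin.natAdd b l).succ)|) := by
        have : v 0 ^ (-e₁) = v 0 ^ (-A) * v 0 ^ (-((b : ℝ) * δ)) := by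
          rw [← Real.rpow_add hs0]; congr 1; rw [he₁]; ring
        rw [this]; ring

/-- **The monomial-log families exist** (`p < q`): there is an integral representation of
dimension `b + d + 1` on `{(s, y, w) | 0 < s < 1, s ≤ y_j ≤ 1, w ∈ ρ.domain}` with integrand
`s^(−p/q) · ∏ y_j⁻¹ · ρ.integrand w`. [Kontsevich–Zagier 2001, §1.1] [folklore] -/
theorem exists_monomialRep {p q b : ℕ} (hpq : p < q) (ρ : IntegralRep d) :
    ∃ M : IntegralRep (b + d + 1),
      M.domain = {v | ∃ (s : ℝ) (y : Fin b → ℝ) (w : Fin d → ℝ),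
        v = Matrix.vecCons s (Fin.append y w) ∧ 0 < s ∧ s < 1 ∧ (∀ j, s ≤ y j ∧ y j ≤ 1) ∧
          w ∈ ρ.domain} ∧
      M.integrand = fun v => (v 0) ^ (-(p : ℝ) / q) * ((∏ j : Fin b, (v (Fin.castAdd d j).succ)⁻¹) *
        ρ.integrand (fun l : Fin d => v (Fin.natAdd b l).succ)) := by
  have hq : 0 < q := lt_of_le_of_lt (Nat.zero_le p) hpq
  have hD := monomialDomain_eq b ρ
  have hDsa : IsSemialgebraic ℚ {v : Fin (b + d + 1) → ℝ | ∃ (s : ℝ) (y : Fin b → ℝ) (w : Fin d → ℝ),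
      v = Matrix.vecCons s (Fin.append y w) ∧ 0 < s ∧ s < 1 ∧ (∀ j, s ≤ y j ∧ y j ≤ 1) ∧
        w ∈ ρ.domain} := by
    rw [hD]; exact isSemialgebraic_monomialDomain b ρ
  refine ⟨⟨_, _, hDsa, ?_, ?_⟩, rfl, rfl⟩
  · rw [hD]; exact isSemialgebraicFunOn_monomialIntegrand p q b hq ρ
  · rw [hD]; exact integrableOn_monomialIntegrand hpq ρ

/-! ### Expandability -/

/-- **The monomial-log families are expandable.** Let `p < q` with `0 < p ∨ 0 < b` (a genuinely
divergent type) and let `M` be a representation of dimension `b + d + 1` on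
`{(s, y, w) | 0 < s < 1, s ≤ y_j ≤ 1, w ∈ ρ.domain}` whose integrand agrees there with
`s^(−p/q) · ∏ y_j⁻¹ · ρ.integrand w`. Then `[M] ∈ expandable`: the elementary divergent product
`P` of type `(p, q, b)` over `ρ` exists (`exists_elementaryRep`), `[P]` is an elementary
generator, and `[P] − [M]` is a fibred relation (`of_elementary_sub_of_mem_fibredRelations`).
[Kontsevich–Zagier 2001, §1.2] [folklore] -/
theorem of_monomial_mem_expandable {p q b : ℕ} (hpq : p < q) (hpb : 0 < p ∨ 0 < b)
    (ρ : IntegralRep d) (M : IntegralRep (b + d + 1))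
    (hMd : M.domain = {v | ∃ (s : ℝ) (y : Fin b → ℝ) (w : Fin d → ℝ),
      v = Matrix.vecCons s (Fin.append y w) ∧ 0 < s ∧ s < 1 ∧ (∀ j, s ≤ y j ∧ y j ≤ 1) ∧
        w ∈ ρ.domain})
    (hMi : ∀ v ∈ M.domain, M.integrand v = (v 0) ^ (-(p : ℝ) / q) *
      ((∏ j : Fin b, (v (Fin.castAdd d j).succ)⁻¹) *
        ρ.integrand (fun l : Fin d => v (Fin.natAdd b l).succ))) :
    of M ∈ expandable := by
  have hq : 0 < q := lt_of_le_of_lt (Nat.zero_le p) hpq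
  obtain ⟨P, hPd, hPi⟩ := exists_elementaryRep (b := b) hpq ρ
  have hP : of P ∈ expandable :=
    mem_expandable_of_mem_elementaryGenerators ⟨p, q, b, d, ρ, P, hq, hpb, hPd, hPi, rfl⟩
  have hPM : of P - of M ∈ fibredRelations :=
    of_elementary_sub_of_mem_fibredRelations hq ρ P M hPd hPi hMd hMi
  have : of M = of P - (of P - of M) := by abel
  rw [this]
  exact expandable.sub_mem hP (mem_expandable_of_mem_fibredRelations hPM)

/-! ### Monomial cylinders in the native dimension -/

/-- Reading a point of `ℝᵈ⁺¹` in the coordinates `(s, y, w)` of the monomial-log families with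
`b = 0` (no `y`), along `finCongr : Fin (0 + d + 1) ≃ Fin (d + 1)`. [folklore] -/
theorem comp_finCongr_eq_vecCons_append (w : Fin (d + 1) → ℝ) (h : 0 + d + 1 = d + 1) :
    (fun i : Fin (0 + d + 1) => w (finCongr h i)) =
      Matrix.vecCons (w 0) (Fin.append (Fin.elim0 : Fin 0 → ℝ) (fun i : Fin d => w i.succ)) := by
  funext i
  refine Fin.cases ?_ (fun k => ?_) i
  · simp only [Matrix.cons_val_zero]
    exact congrArg w (Fin.ext (by simp))
  · rw [Matrix.cons_val_succ]
    refine Fin.addCases (fun j => j.elim0) (fun l => ?_) k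
    rw [Fin.append_right]
    exact congrArg w (Fin.ext (by simp))

/-- **Monomial cylinders** (`b = 0`) in the native dimension `d + 1`: for `0 < p < q` and a
representation `ρ` of dimension `d` there is an EXPANDABLE representation `T` of dimension `d + 1`
on the cylinder `{(s, w) | 0 < s < 1, w ∈ ρ.domain}` whose integrand is `s^(−p/q) · ρ.integrand w`
there (the monomial-log family of type `(p, q, 0)` over `ρ`, reindexed along
`Fin (0 + d + 1) ≃ Fin (d + 1)` — a fibred relabelling). [Kontsevich–Zagier 2001, §1.2] [folklore] -/
theorem exists_monomialCylinder {p q : ℕ} (hpq : p < q) (hp : 0 < p) (ρ : IntegralRep d) :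
    ∃ T : IntegralRep (d + 1),
      T.domain = {z | (0 < z 0 ∧ z 0 < 1) ∧ (fun i : Fin d => z i.succ) ∈ ρ.domain} ∧
      (∀ z ∈ T.domain, T.integrand z = (z 0) ^ (-(p : ℝ) / q) * ρ.integrand (fun i : Fin d => z i.succ)) ∧
      of T ∈ expandable := by
  obtain ⟨M, hMd, hMi⟩ := exists_monomialRep (b := 0) hpq ρ
  have hM : of M ∈ expandable :=
    of_monomial_mem_expandable hpq (Or.inl hp) ρ M hMd (fun v _ => by rw [hMi])
  have h01 : 0 + d + 1 = d + 1 := by omega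
  set e : Fin (0 + d + 1) ≃ Fin (d + 1) := finCongr h01 with he
  have he0 : e 0 = 0 := Fin.ext (by simp [he])
  have hkey : ∀ w : Fin (d + 1) → ℝ, (fun i : Fin (0 + d + 1) => w (e i)) =
      Matrix.vecCons (w 0) (Fin.append (Fin.elim0 : Fin 0 → ℝ) (fun i : Fin d => w i.succ)) :=
    fun w => comp_finCongr_eq_vecCons_append w h01
  have hdom : ∀ w : Fin (d + 1) → ℝ, w ∈ (M.reindex e).domain ↔
      (0 < w 0 ∧ w 0 < 1) ∧ (fun i : Fin d => w i.succ) ∈ ρ.domain := by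
    intro w
    rw [IntegralRep.reindex_domain, mem_setOf_eq, hkey w, hMd]
    simp only [mem_setOf_eq]
    constructor
    · rintro ⟨s, y, w', heq, hs, hs1, -, hw'⟩
      have h0 : w 0 = s := by
        have := congrFun heq 0
        simpa using this
      have hw : (fun i : Fin d => w i.succ) = w' := by
        funext l
        have := congrFun heq (Fin.natAdd 0 l).succ
        simp only [Matrix.cons_val_succ, Fin.append_right] at this
        exact this
      exact ⟨⟨h0 ▸ hs, h0 ▸ hs1⟩, hw ▸ hw'⟩
    · rintro ⟨⟨h0, h1⟩, hw⟩
      exact ⟨w 0, Fin.elim0, _, rfl, h0, h1, fun j => j.elim0, hw⟩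
  refine ⟨M.reindex e, Set.ext hdom, fun w _ => ?_, ?_⟩
  · rw [IntegralRep.reindex_integrand]
    show M.integrand (fun i => w (e i)) = _
    rw [hkey w, hMi]
    simp only [Matrix.cons_val_zero, Finset.univ_eq_empty, Finset.prod_empty, one_mul,
      Matrix.cons_val_succ, Fin.append_right]
  · have h := of_sub_of_reindex_mem_fibredRelations M e he0
    have : of (M.reindex e) = of M - (of M - of (M.reindex e)) := by abel
    rw [this]
    exact expandable.sub_mem hM (mem_expandable_of_mem_fibredRelations h)

end Summit.KontsevichZagierPeriods.ValuedFieldSpecialisation
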